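import Summits.MatrixMultiplication.OmegaCensus.CubeLawParity
import HarnessLib

/-!
# Law-attaining cube triples with a part of size 3 force `dim A/2A ≤ 2`

ω-census, family (b3).  Framing: lottery ticket; floor = certified bounds/negative ranges.

Consequences of the real-character parity theorem `parts_sgnSum_of_law_cube` (`CubeLawParity.lean`): dihedral-like
`G` over `A` (any `c₀`), a TPP triple `(S, T, U)` with cube part sizes attaining `3|S||T||U| + 8 = 8|A|`.

* `no_law_cube_part_three`: if some coset part has exactly `3` elements `{x, y, z}` and `A` admits, for every pair of
  elements, a non-trivial homomorphism `A →+ ZMod 2` vanishing on both (hypothesis `(P)`), there is no such triple: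
  a `φ` vanishing on `y − x`, `z − x` makes `χ = (−1)^φ` constant on `{x, y, z}`, so `χ(T₀) = ±3 ≠ ±1`.
* `pairSeparating_of_three_homs`: `(P)` holds as soon as `A` has three homomorphisms to `ZMod 2` that are jointly
  onto `(ZMod 2)³`, i.e. `dim_{𝔽₂} A/2A ≥ 3` (for `u, v ∈ 𝔽₂³` some non-zero `w` is orthogonal to both).
* Instances (`|A| = 64`, open cube shape `(1,3,7)` of the `|A| ≡ 1 (mod 3)` law classification; `|A| = 136`,
  shapes `(1,5,9), (1,3,15), (3,3,5)`; `|A| = 280`, shape `(1,3,31)`): `(P)` holds for `ℤ₄³`, `ℤ₂²×ℤ₄²`, `ℤ₂⁴×ℤ₄`,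
  `ℤ₂×ℤ₄×ℤ₈`, `ℤ₂³×ℤ₈`, `ℤ₂²×ℤ₁₆`, `ℤ₂³×ℤ₁₇`, `ℤ₂³×ℤ₃₅`; hence no dihedral-like group over these `A` attains the law
  through a cube shape with a part `3` — for the order-64 groups this leaves `ℤ₈²`, `ℤ₄×ℤ₁₆` (and the groups
  `ℤ₆₄`, `ℤ₂×ℤ₃₂` with a cyclic subgroup of index `2`, where the law is attained).
-/

namespace Summit.MatrixMultiplication.OmegaCensus

open Literature.Combinatorics.Additive Finset

/-! ## The real character of a homomorphism `A →+ ZMod 2` -/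

section Hom

variable {A : Type*} [AddCommGroup A] [Fintype A]

omit [Fintype A] in
/-- `(−1)^φ` takes the values `±1`. [folklore] -/
theorem homSgn_val (φ : A →+ ZMod 2) (a : A) :
    (fun a => if φ a = 0 then (1 : ℤ) else -1) a = 1 ∨ (fun a => if φ a = 0 then (1 : ℤ) else -1) a = -1 := by
  simp only
  split_ifs
  · exact Or.inl rfl
  · exact Or.inr rfl

omit [Fintype A] in
/-- `(−1)^φ` is multiplicative. [folklore] -/
theorem homSgn_mul (φ : A →+ ZMod 2) (a b : A) :
    (fun a => if φ a = 0 then (1 : ℤ) else -1) (a + b) =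
      (fun a => if φ a = 0 then (1 : ℤ) else -1) a * (fun a => if φ a = 0 then (1 : ℤ) else -1) b := by
  simp only [map_add]
  have h11 : (1 : ZMod 2) + 1 = 0 := by decide
  have ha : φ a = 0 ∨ φ a = 1 := by generalize φ a = x; fin_cases x; exacts [Or.inl rfl, Or.inr rfl]
  have hb : φ b = 0 ∨ φ b = 1 := by generalize φ b = x; fin_cases x; exacts [Or.inl rfl, Or.inr rfl]
  rcases ha with ha | ha <;> rcases hb with hb | hb <;> simp [ha, hb, h11]

/-- A non-trivial `(−1)^φ` sums to `0` over `A`. [folklore] -/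
theorem homSgn_sum (φ : A →+ ZMod 2) (hφ : ∃ a, φ a ≠ 0) :
    ∑ a, (fun a => if φ a = 0 then (1 : ℤ) else -1) a = 0 := by
  obtain ⟨a₁, ha₁⟩ := hφ
  have hs : (fun a => if φ a = 0 then (1 : ℤ) else -1) a₁ = -1 := by simp only; rw [if_neg ha₁]
  have h1 : ∑ a, (fun a => if φ a = 0 then (1 : ℤ) else -1) a =
      ∑ a, (fun a => if φ a = 0 then (1 : ℤ) else -1) (a + a₁) :=
    (Fintype.sum_equiv (Equiv.addRight a₁) _ _ fun _ => rfl).symm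
  simp only [homSgn_mul, hs, ← Finset.sum_mul] at h1
  simp only at h1 ⊢
  linarith

omit [Fintype A] in
/-- Three homomorphisms to `ZMod 2` that are jointly onto `(ZMod 2)³` separate pairs: for all `x, y` some non-trivial
`φ : A →+ ZMod 2` vanishes on both. [folklore] -/
theorem pairSeparating_of_three_homs (ψ₁ ψ₂ ψ₃ : A →+ ZMod 2)
    (hsurj : ∀ v : ZMod 2 × ZMod 2 × ZMod 2, ∃ a, (ψ₁ a, ψ₂ a, ψ₃ a) = v) :
    ∀ x y : A, ∃ φ : A →+ ZMod 2, (∃ a, φ a ≠ 0) ∧ φ x = 0 ∧ φ y = 0 := by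
  have F : ∀ u v : ZMod 2 × ZMod 2 × ZMod 2, ∃ w z : ZMod 2 × ZMod 2 × ZMod 2,
      w.1 * u.1 + w.2.1 * u.2.1 + w.2.2 * u.2.2 = 0 ∧ w.1 * v.1 + w.2.1 * v.2.1 + w.2.2 * v.2.2 = 0 ∧
        w.1 * z.1 + w.2.1 * z.2.1 + w.2.2 * z.2.2 = 1 := by
    decide
  intro x y
  obtain ⟨w, z, hu, hv, hz⟩ := F (ψ₁ x, ψ₂ x, ψ₃ x) (ψ₁ y, ψ₂ y, ψ₃ y)
  let φ : A →+ ZMod 2 :=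
    { toFun := fun a => w.1 * ψ₁ a + w.2.1 * ψ₂ a + w.2.2 * ψ₃ a
      map_zero' := by simp
      map_add' := fun a b => by simp only [map_add]; ring }
  obtain ⟨a, ha⟩ := hsurj z
  refine ⟨φ, ⟨a, ?_⟩, hu, hv⟩
  show w.1 * ψ₁ a + w.2.1 * ψ₂ a + w.2.2 * ψ₃ a ≠ 0
  have h1 : ψ₁ a = z.1 := congrArg Prod.fst ha
  have h2 : ψ₂ a = z.2.1 := congrArg (fun p => p.2.1) ha
  have h3 : ψ₃ a = z.2.2 := congrArg (fun p => p.2.2) ha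
  rw [h1, h2, h3, hz]
  exact one_ne_zero

end Hom

/-! ## No law-attaining cube triple with a part of size 3 when pairs are separated -/

section DihedralLike

variable {A : Type*} [AddCommGroup A] [DecidableEq A] [Fintype A] {G : Type} [Group G] [DecidableEq G]
  {ρ τ : A → G} {c₀ : A} {S T U : Finset G}

/-- **Cube law shape with a `T`-part of size 3 ⇒ pairs are not separated.**  Dihedral-like `G` over `A`; if every pair
`x, y ∈ A` is annihilated by a common non-trivial `φ : A →+ ZMod 2`, then no TPP triple with cube part sizes,
`|T₀| = 3`, attains `3|S||T||U| + 8 = 8|A|`. [folklore] -/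
theorem no_law_cube_part_three
    (hρρ : ∀ a b, ρ a * ρ b = ρ (a + b)) (hρτ : ∀ a b, ρ a * τ b = τ (b - a))
    (hτρ : ∀ a b, τ a * ρ b = τ (a + b)) (hττ : ∀ a b, τ a * τ b = ρ (c₀ + b - a))
    (hρ : Function.Injective ρ) (hτ : Function.Injective τ) (hne : ∀ a b, ρ a ≠ τ b)
    (hsurj : ∀ g, (∃ a, ρ a = g) ∨ (∃ a, τ a = g))
    (hA : ∀ x y : A, ∃ φ : A →+ ZMod 2, (∃ a, φ a ≠ 0) ∧ φ x = 0 ∧ φ y = 0)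
    (h : TripleProductProperty S T U)
    (hS : (univ.filter fun a : A => ρ a ∈ S).card = (univ.filter fun a : A => τ a ∈ S).card)
    (hT : (univ.filter fun a : A => ρ a ∈ T).card = (univ.filter fun a : A => τ a ∈ T).card)
    (hU : (univ.filter fun a : A => ρ a ∈ U).card = (univ.filter fun a : A => τ a ∈ U).card)
    (hT3 : (univ.filter fun a : A => ρ a ∈ T).card = 3)
    (hV : 3 * (S.card * T.card * U.card) + 8 = 8 * Fintype.card A) : False := by
  obtain ⟨x, y, z, hxy, hxz, hyz, hT₀⟩ := card_eq_three.1 hT3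
  obtain ⟨φ, hφ, hφy, hφz⟩ := hA (y - x) (z - x)
  have hy : φ y = φ x := by rw [map_sub] at hφy; exact (sub_eq_zero.1 hφy)
  have hz : φ z = φ x := by rw [map_sub] at hφz; exact (sub_eq_zero.1 hφz)
  obtain ⟨-, -, hπ, -⟩ := parts_sgnSum_of_law_cube hρρ hρτ hτρ hττ hρ hτ hne hsurj h hS hT hU hV
    (homSgn_mul φ) (homSgn_val φ) (homSgn_sum φ hφ)
  rw [hT₀, sum_insert (by simp [hxy, hxz]), sum_pair hyz] at hπ
  simp only [hy, hz] at hπ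
  split_ifs at hπ <;> omega

/-- The same with the size-3 part in `S` (via the rotation `(U, S, T)`). [folklore] -/
theorem no_law_cube_part_three_left
    (hρρ : ∀ a b, ρ a * ρ b = ρ (a + b)) (hρτ : ∀ a b, ρ a * τ b = τ (b - a))
    (hτρ : ∀ a b, τ a * ρ b = τ (a + b)) (hττ : ∀ a b, τ a * τ b = ρ (c₀ + b - a))
    (hρ : Function.Injective ρ) (hτ : Function.Injective τ) (hne : ∀ a b, ρ a ≠ τ b)
    (hsurj : ∀ g, (∃ a, ρ a = g) ∨ (∃ a, τ a = g))
    (hA : ∀ x y : A, ∃ φ : A →+ ZMod 2, (∃ a, φ a ≠ 0) ∧ φ x = 0 ∧ φ y = 0)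
    (h : TripleProductProperty S T U)
    (hS : (univ.filter fun a : A => ρ a ∈ S).card = (univ.filter fun a : A => τ a ∈ S).card)
    (hT : (univ.filter fun a : A => ρ a ∈ T).card = (univ.filter fun a : A => τ a ∈ T).card)
    (hU : (univ.filter fun a : A => ρ a ∈ U).card = (univ.filter fun a : A => τ a ∈ U).card)
    (hS3 : (univ.filter fun a : A => ρ a ∈ S).card = 3)
    (hV : 3 * (S.card * T.card * U.card) + 8 = 8 * Fintype.card A) : False :=
  no_law_cube_part_three hρρ hρτ hτρ hττ hρ hτ hne hsurj hA h.rotate.rotate hU hS hT hS3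
    (by rw [← hV]; ring)

/-- The same with the size-3 part in `U` (via the rotation `(T, U, S)`). [folklore] -/
theorem no_law_cube_part_three_right
    (hρρ : ∀ a b, ρ a * ρ b = ρ (a + b)) (hρτ : ∀ a b, ρ a * τ b = τ (b - a))
    (hτρ : ∀ a b, τ a * ρ b = τ (a + b)) (hττ : ∀ a b, τ a * τ b = ρ (c₀ + b - a))
    (hρ : Function.Injective ρ) (hτ : Function.Injective τ) (hne : ∀ a b, ρ a ≠ τ b)
    (hsurj : ∀ g, (∃ a, ρ a = g) ∨ (∃ a, τ a = g))
    (hA : ∀ x y : A, ∃ φ : A →+ ZMod 2, (∃ a, φ a ≠ 0) ∧ φ x = 0 ∧ φ y = 0)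
    (h : TripleProductProperty S T U)
    (hS : (univ.filter fun a : A => ρ a ∈ S).card = (univ.filter fun a : A => τ a ∈ S).card)
    (hT : (univ.filter fun a : A => ρ a ∈ T).card = (univ.filter fun a : A => τ a ∈ T).card)
    (hU : (univ.filter fun a : A => ρ a ∈ U).card = (univ.filter fun a : A => τ a ∈ U).card)
    (hU3 : (univ.filter fun a : A => ρ a ∈ U).card = 3)
    (hV : 3 * (S.card * T.card * U.card) + 8 = 8 * Fintype.card A) : False :=
  no_law_cube_part_three hρρ hρτ hτρ hττ hρ hτ hne hsurj hA h.rotate hT hU hS hU3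
    (by rw [← hV]; ring)

end DihedralLike

/-! ## Groups whose pairs are separated by parity homomorphisms -/

section Instances

/-- A ring homomorphism to `ZMod 2` hits every value (`0 ↦ 0`, `1 ↦ 1`). [folklore] -/
theorem exists_ringHom_apply_eq {M : Type*} [Ring M] (π : M →+* ZMod 2) (v : ZMod 2) : ∃ m : M, π m = v := by
  have hv : v = 0 ∨ v = 1 := by fin_cases v; exacts [Or.inl rfl, Or.inr rfl]
  rcases hv with rfl | rfl
  · exact ⟨0, map_zero π⟩
  · exact ⟨1, map_one π⟩

/-- `A = M₁ × M₂ × M₃` with ring homomorphisms `Mᵢ →+* ZMod 2` (e.g. `Mᵢ = ZMod 2^{kᵢ}`, `kᵢ ≥ 1`, with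
`ZMod.castHom`): every pair of elements of `A` is annihilated by a common non-trivial homomorphism `A →+ ZMod 2`.
Covers `ℤ₄³`, `ℤ₂×ℤ₄×ℤ₈`, `ℤ₂²×ℤ₁₆`. [folklore] -/
theorem pairSeparating_prod₃ {M₁ M₂ M₃ : Type*} [Ring M₁] [Ring M₂] [Ring M₃]
    (π₁ : M₁ →+* ZMod 2) (π₂ : M₂ →+* ZMod 2) (π₃ : M₃ →+* ZMod 2) :
    ∀ x y : M₁ × M₂ × M₃, ∃ φ : (M₁ × M₂ × M₃) →+ ZMod 2, (∃ a, φ a ≠ 0) ∧ φ x = 0 ∧ φ y = 0 := by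
  refine pairSeparating_of_three_homs (π₁.toAddMonoidHom.comp (AddMonoidHom.fst _ _))
    (π₂.toAddMonoidHom.comp ((AddMonoidHom.fst _ _).comp (AddMonoidHom.snd _ _)))
    (π₃.toAddMonoidHom.comp ((AddMonoidHom.snd _ _).comp (AddMonoidHom.snd _ _))) ?_
  rintro ⟨v₁, v₂, v₃⟩
  obtain ⟨m₁, h₁⟩ := exists_ringHom_apply_eq π₁ v₁
  obtain ⟨m₂, h₂⟩ := exists_ringHom_apply_eq π₂ v₂
  obtain ⟨m₃, h₃⟩ := exists_ringHom_apply_eq π₃ v₃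
  exact ⟨(m₁, m₂, m₃), by simp [h₁, h₂, h₃]⟩

/-- `A = M₁ × M₂ × M₃ × B` with ring homomorphisms `Mᵢ →+* ZMod 2` and any further factor `B`: every pair of elements
of `A` is annihilated by a common non-trivial homomorphism `A →+ ZMod 2`.  Covers `ℤ₂²×ℤ₄²`, `ℤ₂⁴×ℤ₄`, `ℤ₂³×ℤ₈`,
`ℤ₂³×ℤ₁₇`, `ℤ₂³×ℤ₃₅`. [folklore] -/
theorem pairSeparating_prod₃_prod {M₁ M₂ M₃ : Type*} [Ring M₁] [Ring M₂] [Ring M₃] {B : Type*} [AddCommGroup B]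
    (π₁ : M₁ →+* ZMod 2) (π₂ : M₂ →+* ZMod 2) (π₃ : M₃ →+* ZMod 2) :
    ∀ x y : M₁ × M₂ × M₃ × B, ∃ φ : (M₁ × M₂ × M₃ × B) →+ ZMod 2, (∃ a, φ a ≠ 0) ∧ φ x = 0 ∧ φ y = 0 := by
  refine pairSeparating_of_three_homs (π₁.toAddMonoidHom.comp (AddMonoidHom.fst _ _))
    (π₂.toAddMonoidHom.comp ((AddMonoidHom.fst _ _).comp (AddMonoidHom.snd _ _)))
    (π₃.toAddMonoidHom.comp ((AddMonoidHom.fst _ _).comp ((AddMonoidHom.snd _ _).comp (AddMonoidHom.snd _ _)))) ?_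
  rintro ⟨v₁, v₂, v₃⟩
  obtain ⟨m₁, h₁⟩ := exists_ringHom_apply_eq π₁ v₁
  obtain ⟨m₂, h₂⟩ := exists_ringHom_apply_eq π₂ v₂
  obtain ⟨m₃, h₃⟩ := exists_ringHom_apply_eq π₃ v₃
  exact ⟨(m₁, m₂, m₃, 0), by simp [h₁, h₂, h₃]⟩

/-- The six abelian groups of order `64` of `2`-rank at least `3` and exponent at least `4`, and `ℤ₂³ × ℤ₁₇`,
`ℤ₂³ × ℤ₃₅`: pairs are separated by parity homomorphisms (so `no_law_cube_part_three` applies to every dihedral-like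
group over them). [folklore] -/
theorem pairSeparating_examples :
    (∀ x y : ZMod 4 × ZMod 4 × ZMod 4, ∃ φ : (ZMod 4 × ZMod 4 × ZMod 4) →+ ZMod 2,
      (∃ a, φ a ≠ 0) ∧ φ x = 0 ∧ φ y = 0) ∧
    (∀ x y : ZMod 2 × ZMod 4 × ZMod 8, ∃ φ : (ZMod 2 × ZMod 4 × ZMod 8) →+ ZMod 2,
      (∃ a, φ a ≠ 0) ∧ φ x = 0 ∧ φ y = 0) ∧
    (∀ x y : ZMod 2 × ZMod 2 × ZMod 16, ∃ φ : (ZMod 2 × ZMod 2 × ZMod 16) →+ ZMod 2,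
      (∃ a, φ a ≠ 0) ∧ φ x = 0 ∧ φ y = 0) ∧
    (∀ x y : ZMod 2 × ZMod 2 × ZMod 4 × ZMod 4, ∃ φ : (ZMod 2 × ZMod 2 × ZMod 4 × ZMod 4) →+ ZMod 2,
      (∃ a, φ a ≠ 0) ∧ φ x = 0 ∧ φ y = 0) ∧
    (∀ x y : ZMod 2 × ZMod 2 × ZMod 2 × (ZMod 2 × ZMod 4),
      ∃ φ : (ZMod 2 × ZMod 2 × ZMod 2 × (ZMod 2 × ZMod 4)) →+ ZMod 2, (∃ a, φ a ≠ 0) ∧ φ x = 0 ∧ φ y = 0) ∧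
    (∀ x y : ZMod 2 × ZMod 2 × ZMod 2 × ZMod 8, ∃ φ : (ZMod 2 × ZMod 2 × ZMod 2 × ZMod 8) →+ ZMod 2,
      (∃ a, φ a ≠ 0) ∧ φ x = 0 ∧ φ y = 0) ∧
    (∀ x y : ZMod 2 × ZMod 2 × ZMod 2 × ZMod 17, ∃ φ : (ZMod 2 × ZMod 2 × ZMod 2 × ZMod 17) →+ ZMod 2,
      (∃ a, φ a ≠ 0) ∧ φ x = 0 ∧ φ y = 0) ∧
    (∀ x y : ZMod 2 × ZMod 2 × ZMod 2 × ZMod 35, ∃ φ : (ZMod 2 × ZMod 2 × ZMod 2 × ZMod 35) →+ ZMod 2,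
      (∃ a, φ a ≠ 0) ∧ φ x = 0 ∧ φ y = 0) := by
  have d4 : 2 ∣ 4 := by norm_num
  have d8 : 2 ∣ 8 := by norm_num
  have d16 : 2 ∣ 16 := by norm_num
  exact ⟨pairSeparating_prod₃ (ZMod.castHom d4 (ZMod 2)) (ZMod.castHom d4 (ZMod 2)) (ZMod.castHom d4 (ZMod 2)),
    pairSeparating_prod₃ (RingHom.id (ZMod 2)) (ZMod.castHom d4 (ZMod 2)) (ZMod.castHom d8 (ZMod 2)),
    pairSeparating_prod₃ (RingHom.id (ZMod 2)) (RingHom.id (ZMod 2)) (ZMod.castHom d16 (ZMod 2)),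
    pairSeparating_prod₃_prod (RingHom.id (ZMod 2)) (RingHom.id (ZMod 2)) (ZMod.castHom d4 (ZMod 2)),
    pairSeparating_prod₃_prod (RingHom.id (ZMod 2)) (RingHom.id (ZMod 2)) (RingHom.id (ZMod 2)),
    pairSeparating_prod₃_prod (RingHom.id (ZMod 2)) (RingHom.id (ZMod 2)) (RingHom.id (ZMod 2)),
    pairSeparating_prod₃_prod (RingHom.id (ZMod 2)) (RingHom.id (ZMod 2)) (RingHom.id (ZMod 2)),
    pairSeparating_prod₃_prod (RingHom.id (ZMod 2)) (RingHom.id (ZMod 2)) (RingHom.id (ZMod 2))⟩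

end Instances

end Summit.MatrixMultiplication.OmegaCensus
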